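import Summits.AtomisticToContinuum.BoseEinsteinCondensation.Theses.BECInsertionCorrector
import Summits.AtomisticToContinuum.BoseEinsteinCondensation.Theorems.StaticResponseBound.Negative.Basic
import Literature.MathematicalPhysics.QuantumManyBody.BoseGasStructureFactor
import Literature.MathematicalPhysics.QuantumManyBody.PeriodicBoseGasMomentumSector
import Literature.MathematicalPhysics.QuantumManyBody.PeriodicConfigFourier
import Literature.MathematicalPhysics.QuantumManyBody.PeriodicBoseGasImpurityTranslation
import Literature.MathematicalPhysics.QuantumManyBody.PeriodicHeatFlowSpectralProofs
import HarnessLib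

/-!
# Sector decomposition of a periodic `N`-body function — cell integrals of fibre averages

Helper file for the crux `BECInsertionCorrector.StaticResponseBound` (item
stmt-AtomisticToContinuum-12057), line `stable-fraction-square-completion`, registered stub **C2α**
`stub_sectorDecomposition`.  This second part integrates fibre averages over the cell
`[0,L)^{3N}`.

The stub quantifies over ALL pair potentials `v : ℝ → ℝ≥0∞` (no measurability), so the weight
`W = periodicInteraction v L` of the potential energy is an ARBITRARY `[0,∞]`-valued function, only
known to be `Lℤ³`-periodic in every particle and invariant under the simultaneous translation
`X ↦ X + s𝟙` of all particles.  Lower Lebesgue integrals of non-measurable functions are inner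
integrals, for which Tonelli fails in general; what survives, and suffices, is:

* `secdec_lintegral_mul_lintegral` — **Tonelli with a non-measurable factor depending on one
  variable**: `∫⁻ W(x) (∫⁻ F(x,y) dy) dx = ∫⁻ W(x) F(x,y) d(x,y)` for ARBITRARY `W ≥ 0` and jointly
  measurable finite `F` (a measurable minorant with the same integral,
  `exists_measurable_le_lintegral_eq`, for the weighted measures `F̄ • μ`, `F • (μ ⊗ ν)`;
  `lintegral_withDensity_eq_lintegral_mul_non_measurable`);
* `secdec_lintegral_prod_fibre` — **shear invariance**: `∫⁻_{[0,L)^{3N} × [0,L)³} G(X + s𝟙) =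
  |[0,L)³| ∫⁻_{[0,L)^{3N}} G` for ARBITRARY periodic `G ≥ 0` (the cell-shift invariance
  `lintegral_cellN_comp_add` is measurability-free; the measurable minorant is periodised by a
  countable supremum over the lattice);
* `secdec_tsum_lintegral_mul` — `∑_q ∫⁻ W ρ_q = ∫⁻ W ∑_q ρ_q` for arbitrary `W` and measurable `ρ_q`
  (`lintegral_sum_measure` and `withDensity_tsum`, both measurability-free in `W`);
* `secdec_lintegral_mul_fibre_average` — the combination used by the stub:
  `∫⁻_{cell^N} W(X) · L⁻³∫⁻_{[0,L)³} G(X + s𝟙) ds dX = ∫⁻_{cell^N} W G` for `W` periodic and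
  diagonal-invariant, `G` measurable periodic bounded;
* `secdec_setIntegral_fibre_average` — the Bochner analogue for continuous periodic complex `H`
  (honest Fubini + `setIntegral_cellN_comp_add`), and the behaviour of the density wave
  `ρ̂_k` under `X ↦ X + s𝟙` (`secdec_densityWave_add_const`).

No new definitions.
-/

namespace Summit.AtomisticToContinuum.BoseEinsteinCondensation.Cruxes.StaticResponseBound.StableFractionSquareCompletion

open MeasureTheory Filter
open scoped ENNReal ComplexConjugate Topology
open Literature.MathematicalPhysics.QuantumManyBody.BoseGas
open Summit.AtomisticToContinuum.BoseEinsteinCondensation.Theses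
open Summit.AtomisticToContinuum.BoseEinsteinCondensation.Theorems.StaticResponseBound.Negative

noncomputable section

variable {N : ℕ} {L : ℝ}

/-! ### Tonelli with a non-measurable factor depending on one variable -/

/-- **Tonelli with a non-measurable factor depending on one variable.** For s-finite measures,
an ARBITRARY `W : α → [0,∞]` and a jointly measurable, finite `F` with finite sections integrals,
`∫⁻ W(x) (∫⁻ F(x,y) dν) dμ = ∫⁻ W(p.1) F(p) d(μ ⊗ ν)` (lower Lebesgue integrals in Mathlib's
inner sense).  Both inequalities replace `W` by a measurable minorant with the same integral for
the relevant weighted measure (`exists_measurable_le_lintegral_eq`) and use honest Tonelli for it.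
[folklore] -/
theorem secdec_lintegral_mul_lintegral {α β : Type*} [MeasurableSpace α] [MeasurableSpace β]
    (μ : Measure α) (ν : Measure β) [SFinite μ] [SFinite ν] (W : α → ℝ≥0∞) {F : α × β → ℝ≥0∞}
    (hF : Measurable F) (hFfin : ∀ p, F p < ⊤) (hFint : ∀ x, ∫⁻ y, F (x, y) ∂ν < ⊤) :
    ∫⁻ x, W x * ∫⁻ y, F (x, y) ∂ν ∂μ = ∫⁻ p, W p.1 * F p ∂(μ.prod ν) := by
  have hFbar : Measurable fun x => ∫⁻ y, F (x, y) ∂ν := hF.lintegral_prod_right'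
  have hFx : ∀ x, Measurable fun y => F (x, y) := fun x => hF.comp measurable_prodMk_left
  apply le_antisymm
  · obtain ⟨g, hgm, hgle, hgeq⟩ :=
      exists_measurable_le_lintegral_eq (μ.withDensity fun x => ∫⁻ y, F (x, y) ∂ν) W
    calc ∫⁻ x, W x * ∫⁻ y, F (x, y) ∂ν ∂μ
        = ∫⁻ x, ((fun x => ∫⁻ y, F (x, y) ∂ν) * W) x ∂μ :=
          lintegral_congr fun x => by rw [Pi.mul_apply, mul_comm]
      _ = ∫⁻ x, W x ∂(μ.withDensity fun x => ∫⁻ y, F (x, y) ∂ν) :=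
          (lintegral_withDensity_eq_lintegral_mul_non_measurable μ hFbar
            (Eventually.of_forall hFint) W).symm
      _ = ∫⁻ x, g x ∂(μ.withDensity fun x => ∫⁻ y, F (x, y) ∂ν) := hgeq
      _ = ∫⁻ x, ((fun x => ∫⁻ y, F (x, y) ∂ν) * g) x ∂μ :=
          lintegral_withDensity_eq_lintegral_mul μ hFbar hgm
      _ = ∫⁻ x, ∫⁻ y, g x * F (x, y) ∂ν ∂μ :=
          lintegral_congr fun x => by rw [Pi.mul_apply, mul_comm, lintegral_const_mul _ (hFx x)]
      _ = ∫⁻ p, g p.1 * F p ∂(μ.prod ν) :=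
          (lintegral_prod _ ((hgm.comp measurable_fst).mul hF).aemeasurable).symm
      _ ≤ ∫⁻ p, W p.1 * F p ∂(μ.prod ν) :=
          lintegral_mono fun p => mul_le_mul' (hgle p.1) le_rfl
  · obtain ⟨h, hhm, hhle, hheq⟩ :=
      exists_measurable_le_lintegral_eq ((μ.prod ν).withDensity F) fun p : α × β => W p.1
    calc ∫⁻ p, W p.1 * F p ∂(μ.prod ν)
        = ∫⁻ p, (F * fun p : α × β => W p.1) p ∂(μ.prod ν) :=
          lintegral_congr fun p => by rw [Pi.mul_apply, mul_comm]
      _ = ∫⁻ p, W p.1 ∂((μ.prod ν).withDensity F) :=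
          (lintegral_withDensity_eq_lintegral_mul_non_measurable _ hF
            (Eventually.of_forall hFfin) _).symm
      _ = ∫⁻ p, h p ∂((μ.prod ν).withDensity F) := hheq
      _ = ∫⁻ p, (F * h) p ∂(μ.prod ν) := lintegral_withDensity_eq_lintegral_mul _ hF hhm
      _ = ∫⁻ x, ∫⁻ y, F (x, y) * h (x, y) ∂ν ∂μ := lintegral_prod _ (hF.mul hhm).aemeasurable
      _ ≤ ∫⁻ x, ∫⁻ y, F (x, y) * W x ∂ν ∂μ :=
          lintegral_mono fun x => lintegral_mono fun y => mul_le_mul' le_rfl (hhle (x, y))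
      _ = ∫⁻ x, W x * ∫⁻ y, F (x, y) ∂ν ∂μ :=
          lintegral_congr fun x => by rw [lintegral_mul_const _ (hFx x), mul_comm]

/-! ### Shear invariance of the cell integral for arbitrary periodic integrands -/

/-- **Shear invariance.** For an ARBITRARY `G : (ℝ³)^N → [0,∞]` that is `Lℤ³`-periodic in every
particle, `∫⁻_{(X,s) ∈ [0,L)^{3N} × [0,L)³} G(X + s𝟙) = |[0,L)³| · ∫⁻_{[0,L)^{3N}} G` (inner
integrals).  `≤`: a measurable minorant of `(X,s) ↦ G(X + s𝟙)` is integrated by Tonelli, slice by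
slice below `∫⁻_{cell} G(· + s𝟙) = ∫⁻_{cell} G` (`lintegral_cellN_comp_add`, measurability-free).
`≥`: a measurable minorant of `G` on the cell is periodised by the countable supremum over the
lattice `(Lℤ³)^N` (still below `G`, same cell integral) and then sheared by Tonelli. [folklore] -/
theorem secdec_lintegral_prod_fibre (hL : 0 < L) {G : Config N → ℝ≥0∞}
    (hG : IsTorusPeriodic L G) :
    ∫⁻ p, G (p.1 + fun _ => p.2)
        ∂((volume.restrict (cellN N L)).prod (volume.restrict (cell L))) =
      volume (cell L) * ∫⁻ X in cellN N L, G X := by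
  set μ : Measure (Config N) := volume.restrict (cellN N L) with hμ
  set ν : Measure Space := volume.restrict (cell L) with hν
  have hνu : ν Set.univ = volume (cell L) := Measure.restrict_apply_univ _
  have hsh : Measurable fun p : Config N × Space => p.1 + fun _ => p.2 :=
    measurable_fst.add (measurable_pi_lambda _ fun _ => measurable_snd)
  apply le_antisymm
  · obtain ⟨h, hhm, hhle, hheq⟩ :=
      exists_measurable_le_lintegral_eq (μ.prod ν) fun p : Config N × Space => G (p.1 + fun _ => p.2)
    rw [hheq, lintegral_prod_symm _ hhm.aemeasurable]
    calc ∫⁻ s, ∫⁻ X, h (X, s) ∂μ ∂ν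
        ≤ ∫⁻ s, ∫⁻ X, G (X + fun _ => s) ∂μ ∂ν :=
          lintegral_mono fun s => lintegral_mono fun X => hhle (X, s)
      _ = ∫⁻ s, ∫⁻ X, G X ∂μ ∂ν :=
          lintegral_congr fun s => lintegral_cellN_comp_add hL hG (fun _ => s)
      _ = volume (cell L) * ∫⁻ X, G X ∂μ := by rw [lintegral_const, hνu, mul_comm]
  · obtain ⟨g, hgm, hgle, hgeq⟩ := exists_measurable_le_lintegral_eq μ G
    -- periodise the minorant by the countable supremum over the lattice `(Lℤ³)^N`
    set g₁ : Config N → ℝ≥0∞ := fun X => ⨆ m : Fin N → Fin 3 → ℤ, g (X + latticeVecN L m)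
      with hg₁
    have hg₁m : Measurable g₁ := Measurable.iSup fun m => hgm.comp (measurable_id.add_const _)
    have hg₁le : ∀ X, g₁ X ≤ G X := fun X =>
      iSup_le fun m => (hgle _).trans_eq (hG.add_latticeVecN X m)
    have hgg₁ : ∀ X, g X ≤ g₁ X := fun X =>
      le_iSup_of_le (f := fun m : Fin N → Fin 3 → ℤ => g (X + latticeVecN L m)) 0
        (by rw [latticeVecN_zero, add_zero])
    have hg₁int : ∫⁻ X, g₁ X ∂μ = ∫⁻ X, G X ∂μ :=
      le_antisymm (lintegral_mono hg₁le) (hgeq.trans_le (lintegral_mono hgg₁))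
    have hg₁per : IsTorusPeriodic L g₁ := by
      intro X i k
      simp only [hg₁]
      set δ : Fin N → Fin 3 → ℤ := Pi.single i (Pi.single k 1) with hδ
      have hsurj : Function.Surjective fun m : Fin N → Fin 3 → ℤ => m + δ :=
        fun m => ⟨m - δ, sub_add_cancel m δ⟩
      have he : (Pi.single i (EuclideanSpace.single k L) : Config N) = latticeVecN L δ :=
        single_single_eq_latticeVecN L i k
      rw [he]
      symm
      calc (⨆ m, g (X + latticeVecN L m))
          = ⨆ m, g (X + latticeVecN L (m + δ)) :=
            (hsurj.iSup_comp fun m => g (X + latticeVecN L m)).symm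
        _ = ⨆ m, g (X + latticeVecN L δ + latticeVecN L m) :=
            iSup_congr fun m => by rw [latticeVecN_add, add_comm (latticeVecN L m), add_assoc]
    calc volume (cell L) * ∫⁻ X, G X ∂μ = ∫⁻ s, ∫⁻ X, g₁ X ∂μ ∂ν := by
          rw [lintegral_const, hνu, mul_comm, hg₁int]
      _ = ∫⁻ s, ∫⁻ X, g₁ (X + fun _ => s) ∂μ ∂ν :=
          lintegral_congr fun s => (lintegral_cellN_comp_add hL hg₁per (fun _ => s)).symm
      _ = ∫⁻ p, g₁ (p.1 + fun _ => p.2) ∂(μ.prod ν) :=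
          (lintegral_prod_symm _ (hg₁m.comp hsh).aemeasurable).symm
      _ ≤ ∫⁻ p, G (p.1 + fun _ => p.2) ∂(μ.prod ν) := lintegral_mono fun p => hg₁le _

/-! ### Countable sums against a non-measurable weight -/

/-- `∑_q ∫⁻ W ρ_q = ∫⁻ W ∑_q ρ_q` for an ARBITRARY weight `W ≥ 0` and measurable `ρ_q` with
`∑_q ρ_q` finite (`∫⁻ W ρ_q = ∫⁻ W d(ρ_q • μ)` for the non-measurable `W`, `lintegral_sum_measure`,
`withDensity_tsum`). [folklore] -/
theorem secdec_tsum_lintegral_mul (μ : Measure (Config N)) (W : Config N → ℝ≥0∞)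
    {ρ : (Fin 3 → ℤ) → Config N → ℝ≥0∞} (hρm : ∀ q, Measurable (ρ q))
    (hfin : ∀ X, ∑' q, ρ q X < ⊤) :
    ∑' q, ∫⁻ X, W X * ρ q X ∂μ = ∫⁻ X, W X * ∑' q, ρ q X ∂μ := by
  have hqfin : ∀ q X, ρ q X < ⊤ := fun q X => lt_of_le_of_lt (ENNReal.le_tsum q) (hfin X)
  have hsumf : (∑' q, ρ q) = fun X => ∑' q, ρ q X :=
    funext fun X => tsum_apply (Pi.summable.2 fun _ => ENNReal.summable)
  have hsumm : Measurable (∑' q, ρ q) := by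
    rw [hsumf]
    simp_rw [ENNReal.tsum_eq_iSup_sum]
    exact Measurable.iSup fun s => Finset.measurable_sum s fun i _ => hρm i
  have h1 : ∀ q, ∫⁻ X, W X * ρ q X ∂μ = ∫⁻ X, W X ∂(μ.withDensity (ρ q)) := fun q => by
    rw [lintegral_withDensity_eq_lintegral_mul_non_measurable μ (hρm q)
      (Eventually.of_forall (hqfin q)) W]
    exact lintegral_congr fun X => by rw [Pi.mul_apply, mul_comm]
  simp_rw [h1]
  rw [← lintegral_sum_measure, ← withDensity_tsum hρm,
    lintegral_withDensity_eq_lintegral_mul_non_measurable μ hsumm ?_ W]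
  · exact lintegral_congr fun X => by rw [Pi.mul_apply, mul_comm, hsumf]
  · exact Eventually.of_forall fun X => by rw [hsumf]; exact hfin X

/-! ### The cell integral of a weighted fibre average -/

/-- **The cell integral of a weighted fibre average.** For an ARBITRARY weight `W ≥ 0` on
`(ℝ³)^N` that is `Lℤ³`-periodic in every particle and invariant under `X ↦ X + s𝟙`, and a
measurable, periodic, bounded `G ≥ 0`:
`∫⁻_{[0,L)^{3N}} W(X) · L⁻³ ∫⁻_{[0,L)³} G(X + s𝟙) ds dX = ∫⁻_{[0,L)^{3N}} W(X) G(X) dX`. [folklore] -/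
theorem secdec_lintegral_mul_fibre_average : ∀ (N : ℕ) (L : ℝ), 0 < L →
    ∀ (W : Config N → ℝ≥0∞), IsTorusPeriodic L W →
    (∀ (X : Config N) (s : Space), W (X + fun _ => s) = W X) →
    ∀ (G : Config N → ℝ≥0∞), Measurable G → IsTorusPeriodic L G → ∀ (C : ℝ≥0∞), C ≠ ⊤ →
    (∀ X, G X ≤ C) →
    ∫⁻ X in cellN N L, W X * ((ENNReal.ofReal L ^ 3)⁻¹ * ∫⁻ s in cell L, G (X + fun _ => s)) =
      ∫⁻ X in cellN N L, W X * G X := by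
  intro N L hL W hWper hWdiag G hGm hGper C hC hGle
  set μ : Measure (Config N) := volume.restrict (cellN N L) with hμ
  set ν : Measure Space := volume.restrict (cell L) with hν
  have hsh : Measurable fun p : Config N × Space => p.1 + fun _ => p.2 :=
    measurable_fst.add (measurable_pi_lambda _ fun _ => measurable_snd)
  have hF : Measurable fun p : Config N × Space => G (p.1 + fun _ => p.2) := hGm.comp hsh
  have hvol : volume (cell L) = ENNReal.ofReal L ^ 3 := volume_cell L
  have hL3 : ENNReal.ofReal L ^ 3 ≠ 0 := pow_ne_zero _ (ENNReal.ofReal_pos.2 hL).ne'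
  have hL3' : ENNReal.ofReal L ^ 3 ≠ ⊤ := ENNReal.pow_ne_top ENNReal.ofReal_ne_top
  have hFint : ∀ X, ∫⁻ s, G (X + fun _ => s) ∂ν < ⊤ := fun X =>
    calc ∫⁻ s, G (X + fun _ => s) ∂ν ≤ ∫⁻ _, C ∂ν := lintegral_mono fun s => hGle _
      _ = C * volume (cell L) := by rw [lintegral_const, Measure.restrict_apply_univ]
      _ < ⊤ := ENNReal.mul_lt_top hC.lt_top (by rw [hvol]; exact hL3'.lt_top)
  have hWG : IsTorusPeriodic L (W * G) := fun X i k => by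
    rw [Pi.mul_apply, Pi.mul_apply, hWper, hGper]
  calc ∫⁻ X, W X * ((ENNReal.ofReal L ^ 3)⁻¹ * ∫⁻ s, G (X + fun _ => s) ∂ν) ∂μ
      = (ENNReal.ofReal L ^ 3)⁻¹ * ∫⁻ X, W X * ∫⁻ s, G (X + fun _ => s) ∂ν ∂μ := by
        rw [← lintegral_const_mul' _ _ (ENNReal.inv_ne_top.2 hL3)]
        exact lintegral_congr fun X => by rw [mul_left_comm]
    _ = (ENNReal.ofReal L ^ 3)⁻¹ * ∫⁻ p, W p.1 * G (p.1 + fun _ => p.2) ∂(μ.prod ν) := by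
        rw [secdec_lintegral_mul_lintegral μ ν W hF (fun p => (hGle _).trans_lt hC.lt_top) hFint]
    _ = (ENNReal.ofReal L ^ 3)⁻¹ * ∫⁻ p, (W * G) (p.1 + fun _ => p.2) ∂(μ.prod ν) := by
        congr 1
        exact lintegral_congr fun p => by rw [Pi.mul_apply, hWdiag]
    _ = (ENNReal.ofReal L ^ 3)⁻¹ * (volume (cell L) * ∫⁻ X, (W * G) X ∂μ) := by
        rw [secdec_lintegral_prod_fibre hL hWG]
    _ = ∫⁻ X, W X * G X ∂μ := by
        rw [hvol, ← mul_assoc, ENNReal.inv_mul_cancel hL3 hL3', one_mul]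
        rfl

/-! ### The density wave under the diagonal translation; Bochner fibre averages -/

/-- The density wave is the symmetrised plane wave of `PeriodicBoseGasMomentumSector.lean`:
`ρ̂_k = ∑ⱼ e_k(xⱼ)`. [folklore] -/
theorem secdec_densityWave_eq_planeWaveSum (L : ℝ) (k : Fin 3 → ℤ) (X : Config N) :
    densityWave N L k X = planeWaveSum L k X := by
  unfold densityWave planeWaveSum
  refine Finset.sum_congr rfl fun j _ => ?_
  rw [cellWave_apply]
  congr 1
  push_cast
  ring

/-- **The density wave under the diagonal translation**: `ρ̂_k(X + s𝟙) = e_k(s) ρ̂_k(X)`.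
[folklore] -/
theorem secdec_densityWave_add_const (L : ℝ) (k : Fin 3 → ℤ) (X : Config N) (s : Space) :
    densityWave N L k (X + fun _ => s) = cellWave L k s * densityWave N L k X := by
  rw [secdec_densityWave_eq_planeWaveSum, secdec_densityWave_eq_planeWaveSum]
  have h := hasTotalMomentum_planeWaveSum (M := N) L k s X
  have hX : (fun i => X i + s) = X + fun _ => s := rfl
  rw [hX] at h
  rw [h, cellWave_apply]
  congr 1
  have hsum : (∑ j, (latticeVec (2 * Real.pi / L) k) j * s j) =
      2 * Real.pi / L * ∑ j, (k j : ℝ) * s j := by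
    rw [Finset.mul_sum]
    refine Finset.sum_congr rfl fun j _ => ?_
    simp only [latticeVec, PiLp.toLp_apply]
    ring
  rw [hsum]
  push_cast
  ring

/-- The density wave is `Lℤ³`-periodic in every particle. [folklore] -/
theorem secdec_densityWave_periodic (hL : L ≠ 0) (k : Fin 3 → ℤ) :
    IsTorusPeriodic L (densityWave N L k) := fun X i a => by
  rw [secdec_densityWave_eq_planeWaveSum, secdec_densityWave_eq_planeWaveSum,
    planeWaveSum_periodic hL]

/-- **The cell integral of a fibre average, Bochner form.** For a continuous complex function
`H` on `(ℝ³)^N`, `Lℤ³`-periodic in every particle and bounded by `C`,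
`∫_{[0,L)^{3N}} L⁻³ ∫_{[0,L)³} H(X + s𝟙) ds dX = ∫_{[0,L)^{3N}} H` (honest Fubini for the bounded
continuous integrand on the product of the two finite cells, then the cell shift
`setIntegral_cellN_comp_add`). [folklore] -/
theorem secdec_setIntegral_fibre_average (hL : 0 < L) {H : Config N → ℂ} (hHc : Continuous H)
    (hHper : IsTorusPeriodic L H) {C : ℝ} (hHle : ∀ X, ‖H X‖ ≤ C) :
    ∫ X in cellN N L, ((L ^ 3)⁻¹ : ℝ) • ∫ s in cell L, H (X + fun _ => s) =
      ∫ X in cellN N L, H X := by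
  set μ : Measure (Config N) := volume.restrict (cellN N L) with hμ
  set ν : Measure Space := volume.restrict (cell L) with hν
  haveI : IsFiniteMeasure μ := by
    refine ⟨?_⟩
    rw [hμ, Measure.restrict_apply_univ, volume_cellN]
    exact ENNReal.pow_lt_top (ENNReal.pow_lt_top ENNReal.ofReal_lt_top)
  haveI : IsFiniteMeasure ν := by
    refine ⟨?_⟩
    rw [hν, Measure.restrict_apply_univ, volume_cell]
    exact ENNReal.pow_lt_top ENNReal.ofReal_lt_top
  have hsh : Continuous fun p : Config N × Space => p.1 + fun _ => p.2 :=
    continuous_fst.add (continuous_pi fun _ => continuous_snd)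
  have hint : Integrable (Function.uncurry fun (X : Config N) (s : Space) => H (X + fun _ => s))
      (μ.prod ν) :=
    Integrable.of_bound (hHc.comp hsh).aestronglyMeasurable C
      (Eventually.of_forall fun p => hHle _)
  have hνu : (ν Set.univ).toReal = L ^ 3 := by
    rw [hν, Measure.restrict_apply_univ, volume_cell, ENNReal.toReal_pow,
      ENNReal.toReal_ofReal hL.le]
  calc ∫ X, ((L ^ 3)⁻¹ : ℝ) • ∫ s, H (X + fun _ => s) ∂ν ∂μ
      = ((L ^ 3)⁻¹ : ℝ) • ∫ X, ∫ s, H (X + fun _ => s) ∂ν ∂μ := integral_smul _ _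
    _ = ((L ^ 3)⁻¹ : ℝ) • ∫ s, ∫ X, H (X + fun _ => s) ∂μ ∂ν := by
        rw [integral_integral_swap hint]
    _ = ((L ^ 3)⁻¹ : ℝ) • ∫ s, ∫ X, H X ∂μ ∂ν := by
        congr 1
        exact integral_congr_ae (Eventually.of_forall fun s =>
          setIntegral_cellN_comp_add hL hHper (fun _ => s))
    _ = ∫ X, H X ∂μ := by
        rw [integral_const, smul_smul, measureReal_def, hνu,
          inv_mul_cancel₀ (pow_ne_zero _ hL.ne'), one_smul]

end

end Summit.AtomisticToContinuum.BoseEinsteinCondensation.Cruxes.StaticResponseBound.StableFractionSquareCompletion
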